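import Mathlib
import HarnessLib
import Summits.HubbardSuperconductivity.HubbardSuperconductivity.Theorems.KLProgrammeKLRegimeTwoVolumeSectorOverlapPeriodisation

/-!
# Route `KLProgramme` — crux K3, the nested two-volume pass: the block structure of the sector-field labels is a BOX LATTICE — shifting the block index
# shifts the site by `L·δ` — hence the overlap kernel `E′S` is BLOCK COVARIANT (cell gate-hubbard-kl, seat hubbard-kl-k3c4-p1 g8; `--supports` stmt-…-20440)

The generic substitution–gluing bracket (`…TwoVolumeBlockCovariance`, `…SubstitutionGluingDeepPin`) consumes BLOCK COVARIANCE of the fine substitution kernel: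
`t (e₂⁻¹(β′ + δ, x̄)) (e₁⁻¹(β + δ, y)) = t (e₂⁻¹(β′, x̄)) (e₁⁻¹(β, y))`.  For the block structures of the sector-field labels over a nested torus `Lf = b·L`
(`…TwoVolumeSectorPeriodisation.exists_sectorFieldBlockEquiv`: block `⌊x⃗/L⌋`, projection `((x₀,x⃗),ℓ) ↦ ((x₀, red x⃗), ℓ)` — the only two properties used) this
file shows:

* `sectorBlock_symm_fst_fst / _snd / _site` — the inverse of the block structure in closed form: `e⁻¹(β, ((x₀, x̄), ℓ)) = ((x₀, (L·β_i + x̄_i)_i), ℓ)`;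
* **`sectorBlock_symm_add_site`** — shifting the block index by `δ` shifts the site by the box-lattice vector `(L·δ_i)_i`:
  `site (e⁻¹(β + δ, Y)) = site (e⁻¹(β, Y)) + (L·δ_i)_i`, `sectorBlock_symm_add_eq`;
* **`sectorOverlap_blockCovariant`** — hence, by the spatial translation covariance `sectorOverlap_translate` (p545360), the overlap kernel
  `sectorAnalysisMatrix Lf M β F′ * sectorSubMatrix Lf M β F` is block covariant for ANY two block structures `e₂` (out, `SectorLeg N′`) and `e₁` (in, `SectorLeg N`)
  with those two properties — the hypothesis `hcov` of `…TwoVolumeBlockCovariance.sum_blocks_sum_box_eq_colSum / sum_blocks_erase_sum_box_eq_colOut`.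

Everything is proved; no definition; nothing is asserted about the model beyond algebra.
-/

noncomputable section

namespace Summit.HubbardSuperconductivity.HubbardSuperconductivity.Theorems.TwoPointAssembly

set_option linter.dupNamespace false -- summit = problem name (single-conjunct summit), D-0017

open Finset Literature.MathematicalPhysics.QuantumLattice Literature.Probability.LatticeModels

section BlockShift

variable {b L Lf M N : ℕ}

/-- The inverse of a block structure with the two defining properties, time component: `(e⁻¹(β, Y)).1.1 = Y.1.1`. [folklore] -/
theorem sectorBlock_symm_fst_fst (e : (SpaceTimeIdx Lf M × SectorLeg N) ≃ (Fin 2 → Fin b) × (SpaceTimeIdx L M × SectorLeg N))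
    (he2 : ∀ X', (e X').2 = ((X'.1.1, fun i => (((X'.1.2 i).val : ℕ) : ZMod L)), X'.2)) (β : Fin 2 → Fin b) (Y : SpaceTimeIdx L M × SectorLeg N) :
    (e.symm (β, Y)).1.1 = Y.1.1 := by
  have h := he2 (e.symm (β, Y))
  rw [Equiv.apply_symm_apply] at h
  exact (congrArg (fun q : SpaceTimeIdx L M × SectorLeg N => q.1.1) h).symm

/-- The inverse of a block structure, sector leg: `(e⁻¹(β, Y)).2 = Y.2`. [folklore] -/
theorem sectorBlock_symm_snd (e : (SpaceTimeIdx Lf M × SectorLeg N) ≃ (Fin 2 → Fin b) × (SpaceTimeIdx L M × SectorLeg N))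
    (he2 : ∀ X', (e X').2 = ((X'.1.1, fun i => (((X'.1.2 i).val : ℕ) : ZMod L)), X'.2)) (β : Fin 2 → Fin b) (Y : SpaceTimeIdx L M × SectorLeg N) :
    (e.symm (β, Y)).2 = Y.2 := by
  have h := he2 (e.symm (β, Y))
  rw [Equiv.apply_symm_apply] at h
  exact (congrArg (fun q : SpaceTimeIdx L M × SectorLeg N => q.2) h).symm

/-- **The inverse of a block structure, site**: `(e⁻¹(β, Y)).1.2 = (L·β_i + (Y.1.2 i).val)_i` as sites of the fine torus. [folklore] -/
theorem sectorBlock_symm_site [NeZero Lf]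
    (e : (SpaceTimeIdx Lf M × SectorLeg N) ≃ (Fin 2 → Fin b) × (SpaceTimeIdx L M × SectorLeg N))
    (he1 : ∀ X' i, ((e X').1 i : ℕ) = (X'.1.2 i).val / L)
    (he2 : ∀ X', (e X').2 = ((X'.1.1, fun i => (((X'.1.2 i).val : ℕ) : ZMod L)), X'.2)) (β : Fin 2 → Fin b) (Y : SpaceTimeIdx L M × SectorLeg N) :
    (e.symm (β, Y)).1.2 = fun i => ((L * (β i : ℕ) + (Y.1.2 i).val : ℕ) : ZMod Lf) := by
  set X' := e.symm (β, Y) with hX'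
  have hβ : ∀ i, (β i : ℕ) = (X'.1.2 i).val / L := fun i => by
    rw [← he1 X' i, hX', Equiv.apply_symm_apply]
  have hres : ∀ i, (Y.1.2 i).val = (X'.1.2 i).val % L := fun i => by
    have h := he2 X'
    rw [hX', Equiv.apply_symm_apply] at h
    have hi := congrArg (fun q : SpaceTimeIdx L M × SectorLeg N => q.1.2 i) h
    dsimp only at hi
    rw [← hX'] at hi
    rw [hi, ZMod.val_natCast]
  funext i
  rw [hβ i, hres i, Nat.div_add_mod, ZMod.natCast_zmod_val]

/-- `L·((β + δ)_i) ≡ L·β_i + L·δ_i` on the fine torus `ℤ/(bL)`. [folklore] -/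
theorem natCast_mul_fin_add (hLf : Lf = b * L) (x y : Fin b) :
    ((L * ((x + y : Fin b) : ℕ) : ℕ) : ZMod Lf) = ((L * (x : ℕ) : ℕ) : ZMod Lf) + ((L * (y : ℕ) : ℕ) : ZMod Lf) := by
  rw [Fin.val_add, ← Nat.cast_add, ← mul_add]
  have hdiv := Nat.div_add_mod ((x : ℕ) + (y : ℕ)) b
  have hzero : ((L * (b * (((x : ℕ) + (y : ℕ)) / b)) : ℕ) : ZMod Lf) = 0 := by
    rw [← mul_assoc, mul_comm L b, ← hLf, Nat.cast_mul, ZMod.natCast_self, zero_mul]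
  calc ((L * (((x : ℕ) + (y : ℕ)) % b) : ℕ) : ZMod Lf)
      = ((L * (((x : ℕ) + (y : ℕ)) % b) : ℕ) : ZMod Lf) + ((L * (b * (((x : ℕ) + (y : ℕ)) / b)) : ℕ) : ZMod Lf) := by rw [hzero, add_zero]
    _ = ((L * ((x : ℕ) + (y : ℕ)) : ℕ) : ZMod Lf) := by
        rw [← Nat.cast_add, ← mul_add, add_comm (((x : ℕ) + (y : ℕ)) % b), hdiv]

/-- **Shifting the block index shifts the site by the box-lattice vector**: `site (e⁻¹(β + δ, Y)) = site (e⁻¹(β, Y)) + (L·δ_i)_i`. [folklore] -/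
theorem sectorBlock_symm_add_site [NeZero Lf] (hLf : Lf = b * L)
    (e : (SpaceTimeIdx Lf M × SectorLeg N) ≃ (Fin 2 → Fin b) × (SpaceTimeIdx L M × SectorLeg N))
    (he1 : ∀ X' i, ((e X').1 i : ℕ) = (X'.1.2 i).val / L)
    (he2 : ∀ X', (e X').2 = ((X'.1.1, fun i => (((X'.1.2 i).val : ℕ) : ZMod L)), X'.2))
    (β δ : Fin 2 → Fin b) (Y : SpaceTimeIdx L M × SectorLeg N) :
    (e.symm (β + δ, Y)).1.2 = (e.symm (β, Y)).1.2 + fun i => ((L * (δ i : ℕ) : ℕ) : ZMod Lf) := by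
  rw [sectorBlock_symm_site e he1 he2, sectorBlock_symm_site e he1 he2]
  funext i
  simp only [Pi.add_apply, Nat.cast_add]
  rw [natCast_mul_fin_add hLf]
  ring

/-- **The shifted label in pair form**: `e⁻¹(β + δ, Y) = ((time, site (e⁻¹(β,Y)) + L·δ), ℓ)`. [folklore] -/
theorem sectorBlock_symm_add_eq [NeZero Lf] (hLf : Lf = b * L)
    (e : (SpaceTimeIdx Lf M × SectorLeg N) ≃ (Fin 2 → Fin b) × (SpaceTimeIdx L M × SectorLeg N))
    (he1 : ∀ X' i, ((e X').1 i : ℕ) = (X'.1.2 i).val / L)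
    (he2 : ∀ X', (e X').2 = ((X'.1.1, fun i => (((X'.1.2 i).val : ℕ) : ZMod L)), X'.2))
    (β δ : Fin 2 → Fin b) (Y : SpaceTimeIdx L M × SectorLeg N) :
    e.symm (β + δ, Y) = (((e.symm (β, Y)).1.1, (e.symm (β, Y)).1.2 + fun i => ((L * (δ i : ℕ) : ℕ) : ZMod Lf)), (e.symm (β, Y)).2) := by
  refine Prod.ext (Prod.ext ?_ ?_) ?_
  · rw [sectorBlock_symm_fst_fst e he2, sectorBlock_symm_fst_fst e he2]
  · exact sectorBlock_symm_add_site hLf e he1 he2 β δ Y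
  · rw [sectorBlock_symm_snd e he2, sectorBlock_symm_snd e he2]

/-- **THE OVERLAP KERNEL IS BLOCK COVARIANT.**  For `Lf = b·L`, `β ≠ 0`, any multiplier families and ANY two block structures of the out- and in-labels with block
`⌊x⃗/L⌋` and projection `((x₀,x⃗),ℓ) ↦ ((x₀, red x⃗), ℓ)`:
`(E′S)(e₂⁻¹(β′ + δ, x̄)) (e₁⁻¹(β₁ + δ, y)) = (E′S)(e₂⁻¹(β′, x̄)) (e₁⁻¹(β₁, y))` — the hypothesis `hcov` of `…TwoVolumeBlockCovariance`. [folklore] -/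
theorem sectorOverlap_blockCovariant [NeZero Lf] [NeZero M] {N' : ℕ} (hLf : Lf = b * L) {βt : ℝ} (hβt : βt ≠ 0)
    (F' : Fin N' → FreqMomentum Lf M → ℂ) (F : Fin N → FreqMomentum Lf M → ℂ)
    (e₂ : (SpaceTimeIdx Lf M × SectorLeg N') ≃ (Fin 2 → Fin b) × (SpaceTimeIdx L M × SectorLeg N'))
    (he1₂ : ∀ X' i, ((e₂ X').1 i : ℕ) = (X'.1.2 i).val / L)
    (he2₂ : ∀ X', (e₂ X').2 = ((X'.1.1, fun i => (((X'.1.2 i).val : ℕ) : ZMod L)), X'.2))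
    (e₁ : (SpaceTimeIdx Lf M × SectorLeg N) ≃ (Fin 2 → Fin b) × (SpaceTimeIdx L M × SectorLeg N))
    (he1₁ : ∀ X' i, ((e₁ X').1 i : ℕ) = (X'.1.2 i).val / L)
    (he2₁ : ∀ X', (e₁ X').2 = ((X'.1.1, fun i => (((X'.1.2 i).val : ℕ) : ZMod L)), X'.2))
    (δ β' β₁ : Fin 2 → Fin b) (xbar : SpaceTimeIdx L M × SectorLeg N') (y : SpaceTimeIdx L M × SectorLeg N) :
    (sectorAnalysisMatrix Lf M βt F' * sectorSubMatrix Lf M βt F) (e₂.symm (β' + δ, xbar)) (e₁.symm (β₁ + δ, y)) =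
      (sectorAnalysisMatrix Lf M βt F' * sectorSubMatrix Lf M βt F) (e₂.symm (β', xbar)) (e₁.symm (β₁, y)) := by
  rw [sectorBlock_symm_add_eq hLf e₂ he1₂ he2₂, sectorBlock_symm_add_eq hLf e₁ he1₁ he2₁,
    sectorOverlap_translate hβt F' F _ _ _ _ _ _ _]

/-- **Block covariance of the NORM of the overlap kernel** (the form consumed by `…TwoVolumeBlockCovariance`). [folklore] -/
theorem norm_sectorOverlap_blockCovariant [NeZero Lf] [NeZero M] {N' : ℕ} (hLf : Lf = b * L) {βt : ℝ} (hβt : βt ≠ 0)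
    (F' : Fin N' → FreqMomentum Lf M → ℂ) (F : Fin N → FreqMomentum Lf M → ℂ)
    (e₂ : (SpaceTimeIdx Lf M × SectorLeg N') ≃ (Fin 2 → Fin b) × (SpaceTimeIdx L M × SectorLeg N'))
    (he1₂ : ∀ X' i, ((e₂ X').1 i : ℕ) = (X'.1.2 i).val / L)
    (he2₂ : ∀ X', (e₂ X').2 = ((X'.1.1, fun i => (((X'.1.2 i).val : ℕ) : ZMod L)), X'.2))
    (e₁ : (SpaceTimeIdx Lf M × SectorLeg N) ≃ (Fin 2 → Fin b) × (SpaceTimeIdx L M × SectorLeg N))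
    (he1₁ : ∀ X' i, ((e₁ X').1 i : ℕ) = (X'.1.2 i).val / L)
    (he2₁ : ∀ X', (e₁ X').2 = ((X'.1.1, fun i => (((X'.1.2 i).val : ℕ) : ZMod L)), X'.2)) :
    ∀ (δ β' β₁ : Fin 2 → Fin b) (xbar : SpaceTimeIdx L M × SectorLeg N') (y : SpaceTimeIdx L M × SectorLeg N),
      ‖(sectorAnalysisMatrix Lf M βt F' * sectorSubMatrix Lf M βt F) (e₂.symm (β' + δ, xbar)) (e₁.symm (β₁ + δ, y))‖ =
        ‖(sectorAnalysisMatrix Lf M βt F' * sectorSubMatrix Lf M βt F) (e₂.symm (β', xbar)) (e₁.symm (β₁, y))‖ :=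
  fun δ β' β₁ xbar y => by rw [sectorOverlap_blockCovariant hLf hβt F' F e₂ he1₂ he2₂ e₁ he1₁ he2₁]

end BlockShift

end Summit.HubbardSuperconductivity.HubbardSuperconductivity.Theorems.TwoPointAssembly

end
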